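import Mathlib
import Summits.Ventures.HodgeRepro2.T5TameRamifiedUnitNorms
import Summits.Ventures.HodgeRepro2.T5AdicCompletionNormGroup
import Summits.Ventures.HodgeRepro2.T5RamifiedCharacterCount
import Summits.Ventures.HodgeRepro2.T5QuadraticBasis

/-!
# The norm group of a tamely ramified quadratic extension of local fields has index 2

THE RAMIFIED HALF (residue characteristic `≠ 2`) of the local norm index theorem
(Serre, *Local Fields*, Ch. V §3): on Mathlib's completions `Kv ⊆ Lw` with `[Lw : Kv] = 2`, `ϖ`
irreducible in `O_Kv` but not in `O_Lw` (`T5AdicCompletionRamified`), `σ ≠ 1` and `2` a unit: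

* an ANTI-INVARIANT UNIFORMISER exists: `θ ∈ Lw` with `σ θ = −θ` and `v θ = exp (−1)`
  (`exists_anti_val_eq_exp_neg_one`: from `T5QuadraticBasis.exists_anti_ne_zero`, rescaled by
  powers of `ϖ`; an anti-invariant UNIT is impossible by residue degree one), and its norm
  `N θ = −θ²` is a uniformiser `ρ` of `Kv` (`exists_uniformizer_mem_normGroup`);
* `[Kvˣ : N Lwˣ] = 2` (`index_normGroup_eq_two`): every `y ∈ Kvˣ` is `u ρ^m` with `u` a unit, and
  `u` is a norm iff its residue is a square (`T5TameRamifiedUnitNorms`), which a non-square unit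
  flips — so a character of `Kvˣ` trivial on norms is `y ↦ (ū / k)` on units, i.e. η_v is the
  Legendre symbol of the residue of the unit part (route/T5-route-2.md (A8a) / (A11)).

Declaration per README §8(d): «uses an L-value-free non-vanishing device: NO».
-/

namespace Summit.Ventures.HodgeRepro2.T5TameRamifiedNormGroup

open IsDedekindDomain HeightOneSpectrum IsLocalRing WithZero T5UnramifiedNormApprox
  T5AdicCompletionNormGroup

variable {K : Type*} [Field K] [NumberField K] (v : HeightOneSpectrum (NumberField.RingOfIntegers K))
  {L : Type*} [Field L] [NumberField L] [Algebra K L]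
  (w : HeightOneSpectrum (NumberField.RingOfIntegers L)) [w.asIdeal.LiesOver v.asIdeal]
  (σ : Gal(adicCompletion L w/adicCompletion K v))
  (h2 : Module.finrank (adicCompletion K v) (adicCompletion L w) = 2)
  {ϖ : adicCompletionIntegers K v} (hϖ : Irreducible ϖ)
  {π : adicCompletionIntegers L w} (hπ : Irreducible π)
  (hram : ¬ Irreducible (algebraMap (adicCompletionIntegers K v) (adicCompletionIntegers L w) ϖ))
  (hσ : σ ≠ 1) (h2u : IsUnit (2 : adicCompletionIntegers K v))

include h2 hϖ hπ hram in
/-- `v (alg ϖ) = exp (−2)` in `Lw` (row 109). -/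
theorem val_algebraMap_uniformizer :
    Valued.v (algebraMap (adicCompletion K v) (adicCompletion L w) (ϖ : adicCompletion K v)) = exp (-2) := by
  have := T5RamifiedCharacterCount.val_algebraMap_eq_exp_neg_two v w h2 hϖ hπ hram
  simpa using this

include h2 hϖ hπ hram in
/-- Residue degree one in the field: every `x ∈ Lw` with `v x ≤ 1` is congruent to an element of
`Kv` modulo `𝔪_Lw`. -/
theorem exists_val_sub_algebraMap_lt_one {x : adicCompletion L w} (hx : Valued.v x ≤ 1) :
    ∃ a : adicCompletionIntegers K v,
      Valued.v (x - algebraMap (adicCompletion K v) (adicCompletion L w) (a : adicCompletion K v)) < 1 := by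
  obtain ⟨a, t, ht⟩ := T5AdicCompletionRamified.exists_dvd_sub_algebraMap_of_not_irreducible v w h2 hϖ hπ hram
    ⟨x, (mem_adicCompletionIntegers _ _ _).mpr hx⟩
  refine ⟨a, ?_⟩
  have hcoe : x - algebraMap (adicCompletion K v) (adicCompletion L w) (a : adicCompletion K v) =
      ((⟨x, (mem_adicCompletionIntegers _ _ _).mpr hx⟩ - algebraMap (adicCompletionIntegers K v)
        (adicCompletionIntegers L w) a : adicCompletionIntegers L w) : adicCompletion L w) := rfl
  rw [hcoe, ht, Subring.coe_mul, map_mul]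
  have hπv : Valued.v (π : adicCompletion L w) = exp (-1) :=
    (T5AdicCompletionConductor.irreducible_iff_val_eq_exp_neg_one w π).mp hπ
  calc Valued.v (π : adicCompletion L w) * Valued.v (t : adicCompletion L w)
      ≤ Valued.v (π : adicCompletion L w) * 1 := mul_le_mul' le_rfl ((mem_adicCompletionIntegers _ _ _).mp t.2)
    _ = exp (-1) := by rw [mul_one, hπv]
    _ < 1 := by rw [← exp_zero, exp_lt_exp]; norm_num

include h2u in
/-- `v (2 : Lw) = 1` when `2` is a unit of `O_Kv`. -/
theorem val_two_eq_one :
    Valued.v (algebraMap (adicCompletion K v) (adicCompletion L w) (2 : adicCompletion K v)) = 1 := by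
  obtain ⟨e, he, hval⟩ := T5AdicCompletionIntegral.exists_val_algebraMap_eq_pow v w
  have h2v : Valued.v (2 : adicCompletion K v) = 1 := by
    have := T5AdicCompletionHenselian.val_coe_units_eq_one v h2u.unit
    rw [IsUnit.unit_spec] at this
    exact_mod_cast this
  rw [hval, h2v, one_pow]

include h2 hϖ hπ hram h2u in
/-- There is no anti-invariant unit: `σ ε = −ε` with `v ε = 1` is impossible (residue degree one,
`2` a unit). -/
theorem not_anti_of_val_eq_one {ε : adicCompletion L w} (hε : σ ε = -ε) (h1 : Valued.v ε = 1) :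
    False := by
  obtain ⟨a, ha⟩ := exists_val_sub_algebraMap_lt_one v w h2 hϖ hπ hram (x := ε) h1.le
  set A := algebraMap (adicCompletion K v) (adicCompletion L w) (a : adicCompletion K v) with hA
  have hσA : σ A = A := σ.commutes _
  have ha' : Valued.v (-ε - A) < 1 := by
    have := T5AdicCompletionGaloisInvariance.val_algEquiv_apply v w σ (ε - A)
    rw [map_sub, hε, hσA] at this
    rw [this]; exact ha
  have h2ε : Valued.v (algebraMap (adicCompletion K v) (adicCompletion L w) (2 : adicCompletion K v) * ε) < 1 := by
    have e : algebraMap (adicCompletion K v) (adicCompletion L w) (2 : adicCompletion K v) * ε =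
        (ε - A) - (-ε - A) := by
      rw [map_ofNat]; ring
    rw [e]
    exact lt_of_le_of_lt (Valuation.map_sub _ _ _) (max_lt ha ha')
  rw [map_mul, val_two_eq_one v w h2u, h1, one_mul] at h2ε
  exact lt_irrefl _ h2ε

include h2 hϖ hπ hram hσ h2u in
/-- THE ANTI-INVARIANT UNIFORMISER: `θ ∈ Lw` with `σ θ = −θ` and `v θ = exp (−1)`. -/
theorem exists_anti_val_eq_exp_neg_one :
    ∃ θ : adicCompletion L w, σ θ = -θ ∧ Valued.v θ = exp (-1) := by
  obtain ⟨δ, hδ, hδ0⟩ := T5QuadraticBasis.exists_anti_ne_zero h2 σ hσ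
  set P := algebraMap (adicCompletion K v) (adicCompletion L w) (ϖ : adicCompletion K v) with hP
  have hPv : Valued.v P = exp (-2) := val_algebraMap_uniformizer v w h2 hϖ hπ hram
  have hP0 : P ≠ 0 := by
    intro h; rw [h, map_zero] at hPv; exact exp_ne_zero hPv.symm
  have hσP : σ P = P := σ.commutes _
  have hδv : Valued.v δ ≠ 0 := (Valuation.ne_zero_iff _).mpr hδ0
  set k : ℤ := (Valued.v δ).log with hk
  have hδk : Valued.v δ = exp k := (exp_log hδv).symm
  -- `v (δ * P ^ j) = exp (k - 2 j)`
  have hval : ∀ j : ℤ, Valued.v (δ * P ^ j) = exp (k + j * (-2)) := by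
    intro j
    rw [map_mul, map_zpow₀, hδk, hPv, exp_add, ← exp_zsmul, smul_eq_mul]
  have hanti : ∀ j : ℤ, σ (δ * P ^ j) = -(δ * P ^ j) := by
    intro j
    rw [map_mul, map_zpow₀, hδ, hσP, neg_mul]
  rcases Int.even_or_odd k with ⟨m, hm⟩ | ⟨m, hm⟩
  · -- an anti-invariant unit: impossible
    exfalso
    apply not_anti_of_val_eq_one v w σ h2 hϖ hπ hram h2u (ε := δ * P ^ m) (hanti m)
    rw [hval m, hm]
    convert exp_zero using 2
    ring
  · refine ⟨δ * P ^ (m + 1), hanti _, ?_⟩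
    rw [hval, hm]
    congr 1
    ring

include h2 hσ in
/-- A `σ`-fixed integral element of `Lw` comes from `Kv` (row 126 at the field level). -/
theorem exists_algebraMap_eq_of_fixed {y : adicCompletion L w} (hy : Valued.v y ≤ 1) (hfix : σ y = y) :
    ∃ r : adicCompletionIntegers K v,
      y = algebraMap (adicCompletion K v) (adicCompletion L w) (r : adicCompletion K v) := by
  have hmem : y ∈ adicCompletionIntegers L w := (mem_adicCompletionIntegers _ _ _).mpr hy
  have hτ : T5AdicCompletionConjugation.restrictIntegers v w σ ⟨y, hmem⟩ = ⟨y, hmem⟩ := by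
    apply Subtype.ext
    rw [T5AdicCompletionConjugation.coe_restrictIntegers]
    exact hfix
  obtain ⟨r, hr⟩ := T5AdicCompletionConjugation.exists_algebraMap_eq_of_restrictIntegers_eq v w h2 σ hσ hτ
  exact ⟨r, congrArg Subtype.val hr⟩

include h2 hϖ hπ hram hσ in
/-- The norm of the anti-invariant uniformiser is a uniformiser of `Kv` lying in the norm group:
`N θ = −θ² = ρ` with `v ρ = exp (−1)`. -/
theorem exists_uniformizer_mem_normGroup {θ : adicCompletion L w} (hθ : σ θ = -θ)
    (hθv : Valued.v θ = exp (-1)) :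
    ∃ ρ : (adicCompletion K v)ˣ, Valued.v (ρ : adicCompletion K v) = exp (-1) ∧ ρ ∈ normGroup v w σ := by
  have hfix : σ (θ * σ θ) = θ * σ θ := by
    rw [map_mul, hθ, map_neg, hθ, neg_neg, mul_comm]
  have hle : Valued.v (θ * σ θ) ≤ 1 := by
    rw [map_mul, T5AdicCompletionGaloisInvariance.val_algEquiv_apply v w σ, hθv, ← exp_add]
    rw [← exp_zero, exp_le_exp]; norm_num
  obtain ⟨r, hr⟩ := exists_algebraMap_eq_of_fixed v w σ h2 hσ hle hfix
  -- `v (alg r) = exp (−2)` and `v (alg x) = v x ^ e` with `e = 2`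
  obtain ⟨e, he, hval⟩ := T5AdicCompletionIntegral.exists_val_algebraMap_eq_pow v w
  have he2 : e = 2 := by
    have h1 := hval (ϖ : adicCompletion K v)
    rw [val_algebraMap_uniformizer v w h2 hϖ hπ hram,
      (T5AdicCompletionConductor.irreducible_iff_val_eq_exp_neg_one v ϖ).mp hϖ, ← exp_nsmul,
      exp_inj] at h1
    simp only [smul_neg, nsmul_eq_mul, mul_one] at h1
    omega
  have hrv : Valued.v (r : adicCompletion K v) = exp (-1) := by
    have h1 : Valued.v (θ * σ θ) = exp (-2) := by
      rw [map_mul, T5AdicCompletionGaloisInvariance.val_algEquiv_apply v w σ, hθv, ← exp_add]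
      norm_num
    rw [hr, hval, he2] at h1
    have hr0 : Valued.v (r : adicCompletion K v) ≠ 0 := by
      intro h0
      rw [h0, zero_pow two_ne_zero] at h1
      exact exp_ne_zero h1.symm
    obtain ⟨l, hl⟩ : ∃ l : ℤ, Valued.v (r : adicCompletion K v) = exp l := ⟨_, (exp_log hr0).symm⟩
    rw [hl, ← exp_nsmul, exp_inj] at h1
    rw [hl]
    congr 1
    simp only [nsmul_eq_mul, Nat.cast_ofNat] at h1
    omega
  have hr0 : (r : adicCompletion K v) ≠ 0 := by
    intro h0; rw [h0, map_zero] at hrv; exact exp_ne_zero hrv.symm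
  refine ⟨Units.mk0 _ hr0, hrv, θ, ?_⟩
  rw [Units.val_mk0, ← hr]

include h2 hϖ hπ hram hσ h2u in
/-- A unit `u` of `Kv` (as an element of `Kvˣ` with `v u = 1`) is a norm iff the residue of `u` is a
square (the unit criterion of `T5TameRamifiedUnitNorms`, with `x` integral automatically). -/
theorem mem_normGroup_iff_isSquare_residue (u : (adicCompletion K v)ˣ)
    (hu : Valued.v (u : adicCompletion K v) = 1) :
    u ∈ normGroup v w σ ↔ IsSquare (residue (adicCompletionIntegers K v)
      ⟨(u : adicCompletion K v), (mem_adicCompletionIntegers _ _ _).mpr hu.le⟩) := by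
  have humem : (u : adicCompletion K v) ∈ adicCompletionIntegers K v :=
    (mem_adicCompletionIntegers _ _ _).mpr hu.le
  have huO : IsUnit (⟨(u : adicCompletion K v), humem⟩ : adicCompletionIntegers K v) := by
    rw [← IsLocalRing.notMem_maximalIdeal, T5AdicCompletionResidueField.mem_maximalIdeal_iff]
    simp [hu]
  have hiff := T5TameRamifiedUnitNorms.exists_normConj_eq_iff_isSquare_residue v w σ h2 hϖ hπ hram hσ h2u huO.unit
  rw [IsUnit.unit_spec] at hiff
  rw [← hiff]
  constructor
  · rintro ⟨x, hx⟩
    have hxv : Valued.v x = 1 := by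
      have h := congrArg Valued.v hx
      rw [val_mul_algEquiv v w σ] at h
      obtain ⟨e, he, hval⟩ := T5AdicCompletionIntegral.exists_val_algebraMap_eq_pow v w
      rw [hval, hu, one_pow] at h
      have hx0 : Valued.v x ≠ 0 := by
        intro h0; rw [h0] at h; simp at h
      obtain ⟨l, hl⟩ : ∃ l : ℤ, Valued.v x = exp l := ⟨_, (exp_log hx0).symm⟩
      rw [hl, ← exp_nsmul, ← exp_zero, exp_inj] at h
      rw [hl, ← exp_zero]
      congr 1
      simp only [nsmul_eq_mul, Nat.cast_ofNat] at h
      omega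
    refine ⟨⟨x, (mem_adicCompletionIntegers _ _ _).mpr hxv.le⟩, ?_⟩
    apply Subtype.ext
    rw [normConj_apply, Subring.coe_mul, T5AdicCompletionConjugation.coe_restrictIntegers]
    exact hx
  · rintro ⟨x, hx⟩
    refine ⟨(x : adicCompletion L w), ?_⟩
    have := congrArg Subtype.val hx
    rw [normConj_apply, Subring.coe_mul, T5AdicCompletionConjugation.coe_restrictIntegers] at this
    exact this

include h2 hϖ hπ hram hσ h2u in
/-- THE LOCAL NORM INDEX THEOREM AT A TAMELY RAMIFIED PLACE: `[Kvˣ : N Lwˣ] = 2`. -/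
theorem index_normGroup_eq_two : (normGroup v w σ).index = 2 := by
  classical
  obtain ⟨θ, hθ, hθv⟩ := exists_anti_val_eq_exp_neg_one v w σ h2 hϖ hπ hram hσ h2u
  obtain ⟨ρ, hρv, hρN⟩ := exists_uniformizer_mem_normGroup v w σ h2 hϖ hπ hram hσ hθ hθv
  obtain ⟨ε, hε⟩ := T5TameRamifiedUnitNorms.exists_units_not_isSquare_residue v h2u
  have hεv : Valued.v ((ε : adicCompletionIntegers K v) : adicCompletion K v) = 1 :=
    T5AdicCompletionHenselian.val_coe_units_eq_one v ε
  set εK : (adicCompletion K v)ˣ := Units.map ((adicCompletionIntegers K v).subtype : adicCompletionIntegers K v →* adicCompletion K v) ε with hεK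
  have hεKv : Valued.v (εK : adicCompletion K v) = 1 := by simpa [hεK] using hεv
  rw [Subgroup.index_eq_two_iff]
  refine ⟨εK, fun b => ?_⟩
  -- write `b = u ρ^m` with `v u = 1`
  obtain ⟨u, hu1, hu⟩ := T5UnramifiedCharacter.exists_val_eq_one_mul_zpow hρv b.ne_zero
  set m : ℤ := -(Valued.v (b : adicCompletion K v)).log with hm
  have hu0 : u ≠ 0 := by
    intro h0; rw [h0, map_zero] at hu1; exact zero_ne_one hu1
  set uK : (adicCompletion K v)ˣ := Units.mk0 u hu0 with huK
  have hbK : b = uK * ρ ^ m := by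
    apply Units.ext
    rw [Units.val_mul, Units.val_zpow_eq_zpow_val, huK, Units.val_mk0]
    exact hu
  have hρm : ρ ^ m ∈ normGroup v w σ := Subgroup.zpow_mem _ hρN m
  have hb : b ∈ normGroup v w σ ↔ uK ∈ normGroup v w σ := by
    rw [hbK]; exact Subgroup.mul_mem_cancel_right _ hρm
  have hbε : b * εK ∈ normGroup v w σ ↔ uK * εK ∈ normGroup v w σ := by
    rw [hbK, mul_right_comm]; exact Subgroup.mul_mem_cancel_right _ hρm
  have huKv : Valued.v (uK : adicCompletion K v) = 1 := by rw [huK, Units.val_mk0]; exact hu1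
  have huεv : Valued.v ((uK * εK : (adicCompletion K v)ˣ) : adicCompletion K v) = 1 := by
    rw [Units.val_mul, map_mul, huKv, hεKv, one_mul]
  rw [hb, hbε, mem_normGroup_iff_isSquare_residue v w σ h2 hϖ hπ hram hσ h2u uK huKv,
    mem_normGroup_iff_isSquare_residue v w σ h2 hϖ hπ hram hσ h2u _ huεv]
  -- the residues: `residue (u ε) = residue u * residue ε`
  haveI : Fintype (ResidueField (adicCompletionIntegers K v)) := Fintype.ofFinite _
  have hres : residue (adicCompletionIntegers K v)
      ⟨((uK * εK : (adicCompletion K v)ˣ) : adicCompletion K v), (mem_adicCompletionIntegers _ _ _).mpr huεv.le⟩ =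
      residue (adicCompletionIntegers K v) ⟨(uK : adicCompletion K v), (mem_adicCompletionIntegers _ _ _).mpr huKv.le⟩ *
        residue (adicCompletionIntegers K v) (ε : adicCompletionIntegers K v) := by
    rw [← map_mul]
    congr 1
  have hu0' : residue (adicCompletionIntegers K v)
      ⟨(uK : adicCompletion K v), (mem_adicCompletionIntegers _ _ _).mpr huKv.le⟩ ≠ 0 := by
    rw [residue_ne_zero_iff_isUnit, ← IsLocalRing.notMem_maximalIdeal,
      T5AdicCompletionResidueField.mem_maximalIdeal_iff]
    simp [huKv]
  have hε0 : residue (adicCompletionIntegers K v) (ε : adicCompletionIntegers K v) ≠ 0 :=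
    (residue_ne_zero_iff_isUnit _).mpr ε.isUnit
  rw [hres, T5TameRamifiedUnitNorms.isSquare_mul_iff_not_isSquare hu0' hε0 hε]
  by_cases h : IsSquare (residue (adicCompletionIntegers K v)
      ⟨(uK : adicCompletion K v), (mem_adicCompletionIntegers _ _ _).mpr huKv.le⟩)
  · exact Or.inr ⟨h, not_not.mpr h⟩
  · exact Or.inl ⟨h, h⟩

end Summit.Ventures.HodgeRepro2.T5TameRamifiedNormGroup
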